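import Summits.BirchSwinnertonDyer.BirchSwinnertonDyer.Theorems.KatoDescentPotSupersingularReducibleTameShaBound
import Summits.BirchSwinnertonDyer.BirchSwinnertonDyer.Theorems.KatoDescentPotSupersingularSmallImageEulerSystemBoundOffP
import Literature.NumberTheory.EllipticCurves.Kato2004.HullDescentMultiplierProofs
import Literature.NumberTheory.EllipticCurves.IwasawaEulerCharDivisibilityProofs
import HarnessLib

/-!
# THE `λ`-EXACT `J`-ROAD FOR CRUX M (item 19196): for ANY class `y ∈ 𝐇¹_Γ(T_pW)` with Kato's hull data
# (`j y = λ·z` in the reflexive hull, Thm. 12.5 (3) for `z` read against `X₀`) and Kato's `𝐇² ⊇ X₀` (H2X):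
# `v_p(λ(0)) + ord_p #Sel₀(ℚ_∞, W[p^∞])^Γ ≤ ord_p [H¹(ℤ[1/p], T_pW) : ℤ_p·y₀]` — modulo {H2X, FW, Lim 3.5} only —
# and, with the kernel Poitou–Tate ledger, crux M's inequality with slack `2·ord_p #tors` on the rows `W(ℚ_p)[p] = 0`

Seat `bsd-potss-rkm` g29 (prover, cell `bsd-potss`), item stmt-BirchSwinnertonDyer-19196 `ReducibleKatoMember` = crux M of
K9 `KatoDescentPotSupersingular` (support) / K8-t′ `KatoDescentTamePotSupersingular` (auto-crux); `--supports … --as helper`;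
route-free; closes nothing.  HONEST FRAMING: BSD is proved for no curve by this file; nothing is booked; crux M stays cite-level
on {modularity, HELD 27962 `Kato2004.exists_memberHullZetaCoreInputs`}; theorems only (no definition, no named fact).

## What and why (the correction of g28's «one clause left»)

Seat g28 (`…ReducibleTameShaBound`) reached, on the tame reducible rows and for the `Λ`-adic lift `𝐲` of a `(c,d,a(A))`-zeta
family, `ord_p #Ш(W)[p^∞] + v_p(Tam W) ≤ e + v_p(c_p) + 2·v_p #W(ℚ)_tors` for every `e` with (b′) `ZetaLineOrthIndexAt W p 𝐲₀ e`,
from the `J`-road count `#Sel_str(ℚ,W[p^∞]) ∣ [H¹(ℤ[1/p],T_pW) : ℤ_p·𝐲₀]` (Kato Thm. 13.4 for the SINGLE class `𝐲`).  That count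
is `λ`-LOSSY: by Lemma 13.10 (1) (Kato p. 230) `𝐲 = λ·z_{γ⁰}` in the reflexive hull of `𝐇¹_Γ` for Kato's multiplier
`λ ∈ Λ` (Euler factors at the primes of `A` times the four-cusp combination), so the printed exponent of (b′) for `𝐲₀` is
`e = ord_p(L(W,1)/Ω(W)) + v_p(λ(0)) + t_p − v_p(c_p)` (the normal form of clause (b′) in 27962), and the `J`-road bound carries
`+ v_p(λ(0))` — which print does NOT bound (Kato 13.12: `Z(f,T)/Z` is merely finite).  Kato's own count (Thm. 12.5 (3) + 12.6 +
13.14 + §14.14) is `λ`-EXACT because it divides by the normalised `z_{γ⁰}` in the hull: `[A : ℤ_p·𝐲₀] ≥ p^{v_p(λ(0))}·#𝐇²_Γ`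
(`Kato2004.valuation_add_padicValNat_coinvariants_le_of_hull_smul`, seat g3's module theory).

THIS FILE runs that `λ`-exact count on the `J`-road, i.e. with Kato's ABSTRACT `𝐇²` REPLACED by the descent package `J` of the
named fact H2X (`exists_iwasawaH2Data_fineSelmerDual_embedding`: `X₀ ↪ J.H2` with finite cokernel, (14.14.1) pinned to `proj₀`)
and Kato's Thm. 12.5 (3) read AGAINST THE CONSTRUCTED `X₀ = (W.fineSelmerDualData κ hγ).X` (`ℓ_𝔮(X₀) ≤ ℓ_𝔮(F/Λz)` at the
height-one primes `𝔮 ≠ (p)`; at `𝔮 = (p)` the kernel theorem `μ(X₀) = 0` on reducible rows, Ferrero–Washington + Lim 2017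
Thm. 3.5, does the work):

* §1 `lengthAt_quotient_span_eq_of_finite_coker` (module theory: `ℓ_𝔮(H/Λy) = ℓ_𝔮(F/Λ·j y)` for `j : H ↪ F` of finite index,
  `ht 𝔮 ≤ 1`), `finite_coinvariants_and_padicValNat_le_of_embedding` (`X ↪ J.H2` finite coker, `X_Γ` finite ⟹ `(J.H2)_Γ`
  finite and `ord_p #X_Γ ≤ ord_p #(J.H2)_Γ`), `natCard_quotient_ι_eq_index` (`[J.A : Λ·ι(ȳ)] = [H¹(ℤ[1/p],T_pW) : ℤ_p·y₀]`).
* §2 **`valuation_add_padicValNat_fineSelmer_invariants_le_index_of_hull`** — `W[p]` reducible, `p ≠ 2`, `(κ,γ)` cyclotomic,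
  `W(ℚ)` and `Ш(W)[p^∞]` finite, ANY `y ∈ 𝐇¹_Γ(T_pW)` with `y₀` of infinite order, hull data `(F, j, z, λ)` with `j y = λ·z` and
  `ℓ_𝔮(X₀) ≤ ℓ_𝔮(F/Λz)` off `(p)`, a package `J` with `X₀ ↪ J.H2` of finite cokernel:
  `Sel₀(ℚ_∞,W[p^∞])^Γ` is finite and **`v_p(λ(0)) + ord_p #Sel₀(ℚ_∞,W[p^∞])^Γ ≤ ord_p [H¹(ℤ[1/p],T_pW) : ℤ_p·y₀]`** — modulo
  {FW, Lim 3.5} (NO Thm. 13.4, NO Serre, NO non-CM hypothesis, NO Euler-system hypothesis on `y`).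
* SEQUEL `…ReducibleHullShaBound` (same namespace) §3 **`padicValNat_sha_add_tamagawa_add_valuation_le_of_zetaLineOrthIndexAt_of_hull`** — on the rows with `W(ℚ_p)[p] = 0`
  (exact control, seat g27; `W(ℚ_{p,∞})[p^∞] = 0`, seat g26, discharges H2X's hypothesis): for every `e` with (b′)
  `ZetaLineOrthIndexAt W p y₀ e`, **`ord_p #Ш(W)[p^∞] + v_p(Tam W) + v_p(λ(0)) ≤ e + v_p(c_p) + 2·v_p #W(ℚ)_tors`** — modulo
  {H2X, FW, Lim 3.5}, the Poitou–Tate ledger (parts 39–58) and PT over `ℚ` being kernel theorems; and the NORMAL FORM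
  `…_of_normalForm`: if `(e : ℤ) = ord_p q + v_p(λ(0)) + t_p − v_p(c_p)` with `L(W,1)/Ω(W) = q` (27962's clause (b′) verbatim) then
  **`ord_p #Ш(W)[p^∞] + v_p(Tam W) ≤ ord_p q + t_p + 2·v_p #W(ℚ)_tors`** (`t_p = ord_p #W(ℚ_p)[p^∞] = 0` on these rows; kept symbolic);
  rows `…_of_addv_of_eleven_le` (every additive `p ≥ 11`: all (t′) rows of K8-t′), `…_of_addv` (`p ∈ {5,7}` off Kodaira II/III).

READING (for the planner's T-M-TAME, TARGET R294).  The honest carving of 27962 that closes crux M on the tame rows from atoms is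
NOT «Z0 ⊕ (b′) with `e ≤ ord q + ord #tors − v(c_p)`» (g28 memo §4: that clause asserts `v_p(λ(0)) ≤ ord_p #W_K(ℚ)_tors` for some
admissible `(c,d,a,A)`, unprinted) but the HULL SUB-PACKAGE of 27962: its fields `F, j, z, lam, j_y, z_ne_zero, isTorsion_quotient,
finite_coker, lam_constantCoeff_ne_zero, zetaLineIndex` with `divisibility_offP` stated against `X₀` — exactly the binders of §2/§3 —
dropping the seven abstract-`𝐇²` fields `H2, finite_H2, isTorsion_H2, A/toH1/ι/π/(14.14.1), mu_H2, katoH2Count`, which H2X + the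
kernel exact control + this file supply on the tame rows.  Sources of the kept clauses: Kato Thm. 12.4 (2), 12.5 (1)–(3), 12.6,
Lemma 13.10 (1), 13.12, 13.14 (hull), Prop. 14.16 (2) `ν` / Lemma 14.18 with Kim §3.2.3 (b′).

References: K. Kato, Astérisque 295 (2004), Thm. 12.4–12.6 (pp. 221–222), Lemma 13.10 (1) (p. 230), 13.12 (p. 231), 13.14 (p. 234),
Thm. 14.5 (p. 236), (14.9.1)–(14.9.3) (pp. 239–240), §14.14 (14.14.1)–(14.14.2) and Lemma 14.15 (pp. 243–244), Prop. 14.16 (2)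
(pp. 244–245), Lemma 14.18 (pp. 247–248) [Kato2004Asterisque]; R. Greenberg, LNM 1716 (1999) §4 Lemma 4.2 [GreenbergLNM1716];
M. F. Lim, §3 Thm. 3.5 [Lim2017FineSelmer]; B. Ferrero, L. Washington, Ann. of Math. 109 (1979) [FerreroWashington1979];
J. S. Milne, *ADT* I Thm. 4.10 [MilneADT2006]; C.-H. Kim, AJM 148 §3.2.3 [Kim2022StructureSelmer].
-/

-- the summit and its single problem are both named `BirchSwinnertonDyer` (registry layout D-0017)
set_option linter.dupNamespace false
set_option autoImplicit false

noncomputable section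

open scoped Classical NumberField TensorProduct
open Function Field NumberField IsDedekindDomain WeierstrassCurve CongruenceSubgroup
open Literature.NumberTheory.EllipticCurves Literature.NumberTheory.EllipticCurves.GreenbergSelmer
open Literature.NumberTheory.GaloisRepresentations
open Literature.NumberTheory.EllipticCurves.Kato2004 Literature.NumberTheory.EllipticCurves.Kato2004.EulerSystemValues
open Literature.NumberTheory.EllipticCurves.IwasawaAlgebra Literature.NumberTheory.EllipticCurves.IwasawaDual
open Literature.NumberTheory.GaloisRepresentations.DiscreteGaloisModule Literature.NumberTheory.GaloisCohomology
open Literature.NumberTheory.EllipticCurves.Rank1Residual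
open Summit.BirchSwinnertonDyer.Rank1Residual
open Summit.BirchSwinnertonDyer.Rank1Residual.X11b.Levels Summit.BirchSwinnertonDyer.Rank1Residual.X11b.LocBridge
  Summit.BirchSwinnertonDyer.Rank1Residual.X11b.AcSelmer
open Summit.BirchSwinnertonDyer.BirchSwinnertonDyer.Theorems
open Summit.BirchSwinnertonDyer.BirchSwinnertonDyer.Theorems.ASideJunction
open Summit.BirchSwinnertonDyer.BirchSwinnertonDyer.Theorems.KatoFiniteLevelCount
open Summit.BirchSwinnertonDyer.BirchSwinnertonDyer.Theorems.StrictSelmerBridge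
open Summit.BirchSwinnertonDyer.BirchSwinnertonDyer.Theorems.IntegralH1LayerZeroTop

universe u

namespace Summit.BirchSwinnertonDyer.BirchSwinnertonDyer.Theorems.ReducibleHullDescentCount

/-! ## §1 Module theory and package algebra -/

section Module

variable {p : ℕ} [Fact p.Prime]
  {F H : Type u} [AddCommGroup F] [Module (IwasawaAlgebra p) F] [AddCommGroup H] [Module (IwasawaAlgebra p) H]

/-- **`ℓ_𝔮(H/Λy) = ℓ_𝔮(F/Λ·j(y))` at every prime of height `≤ 1`** for an injective `Λ`-linear `j : H → F` with FINITE cokernel: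
the induced map `H/Λy → F/Λ·j(y)` is injective (as `j` is) with finite cokernel (a quotient of `F/j(H)`), i.e. a pseudo-isomorphism.
Module theory over `Λ = ℤ_p⟦T⟧` only (the argument of `Kato2004.lengthAt_primeT_quotient_span_eq_zero_of_hull`, at any `𝔮`).
[cite: Kato2004Asterisque, 13.14 (p. 234) and §14.14 (p. 243)] [cite: Washington1997, §13.2] -/
theorem lengthAt_quotient_span_eq_of_finite_coker (j : H →ₗ[IwasawaAlgebra p] F) (hj : Function.Injective j)
    (hcok : Finite (F ⧸ LinearMap.range j)) (y : H) (𝔮 : PrimeSpectrum (IwasawaAlgebra p)) (h𝔮 : 𝔮.asIdeal.height ≤ 1) :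
    Module.lengthAt (IwasawaAlgebra p) (H ⧸ (IwasawaAlgebra p) ∙ y) 𝔮 =
      Module.lengthAt (IwasawaAlgebra p) (F ⧸ (IwasawaAlgebra p) ∙ j y) 𝔮 := by
  set Y : Submodule (IwasawaAlgebra p) H := (IwasawaAlgebra p) ∙ y with hY
  set W : Submodule (IwasawaAlgebra p) F := (IwasawaAlgebra p) ∙ j y with hW
  have hmap : Y.map j = W := by rw [hY, hW, Submodule.map_span, Set.image_singleton]
  have hcomap : Y ≤ W.comap j := by rw [← hmap]; exact Submodule.le_comap_map _ _
  set θ : (H ⧸ Y) →ₗ[IwasawaAlgebra p] F ⧸ W := Submodule.mapQ Y W j hcomap with hθ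
  have hθ_inj : Function.Injective θ := by
    rw [← LinearMap.ker_eq_bot, hθ, Submodule.mapQ, Submodule.ker_liftQ, LinearMap.ker_comp,
      Submodule.ker_mkQ, ← hmap, Submodule.comap_map_eq, LinearMap.ker_eq_bot.mpr hj, sup_bot_eq,
      Submodule.mkQ_map_self]
  have hsurj : Function.Surjective
      ((LinearMap.range j).liftQ ((LinearMap.range θ).mkQ.comp W.mkQ) (by
        rintro _ ⟨h, rfl⟩
        rw [LinearMap.mem_ker, LinearMap.comp_apply, Submodule.mkQ_apply, Submodule.mkQ_apply,
          Submodule.Quotient.mk_eq_zero]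
        exact ⟨Submodule.Quotient.mk h, by rw [hθ, Submodule.mapQ_apply]⟩)) := by
    intro q
    obtain ⟨q', rfl⟩ := Submodule.Quotient.mk_surjective _ q
    obtain ⟨x, rfl⟩ := Submodule.Quotient.mk_surjective _ q'
    exact ⟨Submodule.Quotient.mk x, rfl⟩
  haveI : Finite ((F ⧸ W) ⧸ LinearMap.range θ) := Finite.of_surjective _ hsurj
  exact lengthAt_eq_of_injective_of_finite_quotient θ hθ_inj inferInstance 𝔮 h𝔮

end Module

section Package

variable {W : WeierstrassCurve ℚ} [W.IsElliptic] {p : ℕ} [Fact p.Prime]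
  [ContinuousSMul ℤ_[p] (W.tateModule p)] {κ : ZpExtension ℚ p} {γ : absoluteGaloisGroup ℚ}
  {I : IwasawaH1Data W p κ γ}

/-- A `Λ`-module embedded in a torsion `Λ`-module is torsion. [folklore] -/
theorem isTorsion_of_injective {X N : Type*} [AddCommGroup X] [Module (IwasawaAlgebra p) X]
    [AddCommGroup N] [Module (IwasawaAlgebra p) N] (e : X →ₗ[IwasawaAlgebra p] N) (he : Function.Injective e)
    (hN : Module.IsTorsion (IwasawaAlgebra p) N) : Module.IsTorsion (IwasawaAlgebra p) X := by
  intro x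
  obtain ⟨a, ha⟩ := @hN (e x)
  refine ⟨a, he ?_⟩
  rw [map_zero, Submonoid.smul_def, map_smul, ← Submonoid.smul_def, ha]

/-- **`X ↪ J.H2` with finite cokernel and `X_Γ` finite ⟹ `(J.H2)^Γ`, `(J.H2)_Γ` finite and `ord_p #X_Γ ≤ ord_p #(J.H2)_Γ`.**
`X` and `J.H2` have equal lengths at every height-one prime (pseudo-isomorphism), hence equal `Γ`-Euler characteristics
`#(·)_Γ/#(·)^Γ` (Greenberg L.4.2 / Kato L.14.15), while `X[T] ↪ J.H2[T]`.  Package algebra; `J` any descent package.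
[cite: Kato2004Asterisque, (14.9.1) (p. 239), §14.14 and Lemma 14.15 (pp. 243–244)] [cite: GreenbergLNM1716, §4 Lemma 4.2 (p. 102)] -/
theorem finite_coinvariants_and_padicValNat_le_of_embedding (J : IwasawaH2Data W p κ γ I)
    {X : Type} [AddCommGroup X] [Module (IwasawaAlgebra p) X]
    (e : X →ₗ[IwasawaAlgebra p] J.H2) (he : Function.Injective e) (hcok : Finite (J.H2 ⧸ LinearMap.range e))
    (hfinX : Finite (coinvariants p X)) :
    Finite (invariants p J.H2) ∧ Finite (coinvariants p J.H2) ∧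
      padicValNat p (Nat.card (coinvariants p X)) ≤ padicValNat p (Nat.card (coinvariants p J.H2)) := by
  haveI := J.finite_H2
  haveI : Module.Finite (IwasawaAlgebra p) X := Module.Finite.of_injective e he
  have hX : Module.IsTorsion (IwasawaAlgebra p) X := isTorsion_of_injective e he J.isTorsion_H2
  have hlen : ∀ 𝔮 : PrimeSpectrum (IwasawaAlgebra p), 𝔮.asIdeal.height ≤ 1 →
      Module.lengthAt (IwasawaAlgebra p) X 𝔮 = Module.lengthAt (IwasawaAlgebra p) J.H2 𝔮 :=
    fun 𝔮 h𝔮 ↦ lengthAt_eq_of_injective_of_finite_quotient e he hcok 𝔮 h𝔮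
  have h0X : Module.lengthAt (IwasawaAlgebra p) X (primeT p) = 0 := lengthAt_primeT_eq_zero_of_finite_coinvariants X hX hfinX
  have h0J : Module.lengthAt (IwasawaAlgebra p) J.H2 (primeT p) = 0 := by
    rw [← hlen (primeT p) (le_of_eq (height_primeT p))]; exact h0X
  obtain ⟨hiJ, hcJ, -⟩ := card_coinvariants_of_lengthAt_eq_zero J.H2 J.isTorsion_H2 h0J
  obtain ⟨hiX, -, -⟩ := card_coinvariants_of_lengthAt_eq_zero X hX h0X
  haveI := hiJ; haveI := hcJ; haveI := hiX; haveI := hfinX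
  have key := padicValNat_coinvariants_add_le_of_lengthAt_le (M := X) (N := J.H2) hX J.isTorsion_H2
    (fun 𝔮 h𝔮 ↦ (hlen 𝔮 (le_of_eq h𝔮)).le) hcJ
  have hdvd : Nat.card (invariants p X) ∣ Nat.card (invariants p J.H2) :=
    AddSubgroup.card_dvd_of_injective (invariantsMap e).toAddMonoidHom (invariantsMap_injective e he)
  have hJ0 : Nat.card (invariants p J.H2) ≠ 0 := Nat.card_pos.ne'
  have hinv : padicValNat p (Nat.card (invariants p X)) ≤ padicValNat p (Nat.card (invariants p J.H2)) :=
    (padicValNat_dvd_iff_le hJ0).mp (dvd_trans pow_padicValNat_dvd hdvd)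
  exact ⟨hiJ, hcJ, by omega⟩

/-- **`[J.A : Λ·ι(ȳ)] = [H¹(ℤ[1/p],T_pW) : ℤ_p·y₀]`** (`y₀ = proj₀ y`; `κ` cyclotomic, `γ` a generator): both equal
`#J.H2[T] · [𝐇¹_Γ/T : Λȳ]` — the package side by (14.14.1) (`Kato2004.natCard_quotient_eq_of_exact`), the pinned side by
seat g16's `natCard_quotient_span_eq_natCard_descentCokernel_mul` and `J.descentCokernelEquiv`.
[cite: Kato2004Asterisque, §14.14 (14.14.1) (p. 243)] -/
theorem natCard_quotient_ι_eq_index (hκ : κ.IsCyclotomic) (hγ : κ.IsTopGenerator γ) (J : IwasawaH2Data W p κ γ I) (y : I.H) :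
    Nat.card (J.A ⧸ (IwasawaAlgebra p) ∙ J.ι (Submodule.Quotient.mk y)) =
      Nat.card (integralH1 (tateRep W p) p (κ.layerSubgroup 0) ⧸
        Submodule.span ℤ_[p] {(⟨I.proj 0 y, I.proj_mem 0 y⟩ : integralH1 (tateRep W p) p (κ.layerSubgroup 0))}) := by
  rw [Kato2004.natCard_quotient_eq_of_exact J.ι J.π J.ι_injective J.π_surjective J.exact_ι_π,
    ReducibleFineSelmerDescentCount.natCard_quotient_span_eq_natCard_descentCokernel_mul hκ hγ I y,
    Nat.card_congr J.descentCokernelEquiv.toEquiv]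

end Package

/-! ## §2 The `λ`-exact count for any class with hull data, on a reducible row -/

section Hull

variable (W : WeierstrassCurve ℚ) [W.IsElliptic] (p : ℕ) [Fact p.Prime]
  [ContinuousSMul ℤ_[p] (W.tateModule p)]
  [Finite W.toAffine.Point] [Finite (AddCommGroup.primaryComponent W.sha p)]
  {κ : ZpExtension ℚ p} {γ : absoluteGaloisGroup ℚ}

/-- **THE `λ`-EXACT `J`-ROAD COUNT.**  `W/ℚ` elliptic with `W[p]` REDUCIBLE, `p ≠ 2`, `W(ℚ)` and `Ш(W)[p^∞]` finite, `(κ, γ)`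
cyclotomic, `I` the pinned `𝐇¹_Γ(T_pW)`; `y ∈ 𝐇¹_Γ(T_pW)` ANY class whose bottom class `y₀ = proj₀ y` has infinite order; HULL DATA:
`F` finitely generated torsion-free, `j : 𝐇¹_Γ ↪ F` of finite cokernel (13.14 / Wuthrich L.12), `z ∈ F`, `z ≠ 0`, `F/Λz` torsion
(Kato's normalised `z_{γ⁰}`, Thm. 12.5 (1)(2), 12.6), `λ ∈ Λ` with `λ(0) ≠ 0` and `j y = λ·z` (Lemma 13.10 (1)), and Kato's
Thm. 12.5 (3) read against the constructed dual fine Selmer group: `ℓ_𝔮(X₀) ≤ ℓ_𝔮(F/Λz)` at every height-one `𝔮 ≠ (p)`; a descent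
package `J : IwasawaH2Data W p κ γ I` with an injective `Λ`-linear `X₀ → J.H2` of finite cokernel (the content of H2X).  THEN
`Sel₀(ℚ_∞,W[p^∞])^Γ` and `H¹(ℤ[1/p],T_pW)/ℤ_p y₀` are finite and
**`v_p(λ(0)) + ord_p #Sel₀(ℚ_∞, W[p^∞])^Γ ≤ ord_p [H¹(ℤ[1/p], T_pW) : ℤ_p·y₀]`** — modulo Ferrero–Washington and Lim 2017
Thm. 3.5 (`μ(X₀) = 0` on the reducible row); no Thm. 13.4, no Serre, no CM hypothesis, no Euler-system hypothesis on `y`.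
PROOF: `ℓ_𝔮(J.H2) = ℓ_𝔮(X₀) ≤ ℓ_𝔮(F/Λz)` at every height-one `𝔮` (`= 0` at `(p)`); `(𝐇¹_Γ/Λy)_Γ` finite (`y₀` of infinite
order) ⟹ `ℓ_{(T)}(F/Λz) = 0` ⟹ `(J.H2)_Γ` finite; seat g3's hull descent `v_p(λ(0)) + ord #(J.H2)_Γ ≤ ord [J.A : Λ·ι(ȳ)]`;
`[J.A : Λ·ι(ȳ)] = [A : ℤ_p y₀]`; `#(X₀)_Γ ≤ #(J.H2)_Γ` in valuation (§1); `#(X₀)_Γ = #Sel₀(ℚ_∞)^Γ` (duality of the pin).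
[cite: Kato2004Asterisque, Thm. 12.5 (3) and 12.6 (p. 222), Lemma 13.10 (1) (p. 230), 13.14 (p. 234), §14.14 (14.14.1) and Lemma 14.15 (pp. 243–244)]
[cite: GreenbergLNM1716, §4 Lemma 4.2 (p. 102)] [cite: Lim2017FineSelmer, §3 Thm. 3.5] -/
theorem valuation_add_padicValNat_fineSelmer_invariants_le_index_of_hull
    (hLim : Lim2017.thm35_fineSelmerDual_moduleFinite_of_classicalMuVanishes_of_le_divisionField)
    (hFW : Literature.NumberTheory.IwasawaTheory.ferreroWashington1979_classicalMuVanishes)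
    (hp : p ≠ 2) (hκ : κ.IsCyclotomic) (hγ : κ.IsTopGenerator γ) (hred : ¬ W.HasIrreducibleModPGaloisRep p)
    (I : IwasawaH1Data W p κ γ) (J : IwasawaH2Data W p κ γ I)
    (eX : (W.fineSelmerDualData κ hγ).X →ₗ[IwasawaAlgebra p] J.H2) (heX : Function.Injective eX)
    (hcokX : Finite (J.H2 ⧸ LinearMap.range eX))
    {F : Type} [AddCommGroup F] [Module (IwasawaAlgebra p) F] [Module.Finite (IwasawaAlgebra p) F]
    [NoZeroSMulDivisors (IwasawaAlgebra p) F]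
    (j : I.H →ₗ[IwasawaAlgebra p] F) (hj : Function.Injective j) (hcok : Finite (F ⧸ LinearMap.range j))
    (z : F) (hz : z ≠ 0) (hFZ : Module.IsTorsion (IwasawaAlgebra p) (F ⧸ (IwasawaAlgebra p) ∙ z))
    (hdiv : ∀ 𝔮 : PrimeSpectrum (IwasawaAlgebra p), 𝔮.asIdeal.height = 1 → 𝔮.asIdeal ≠ augIdealP p →
      Module.lengthAt (IwasawaAlgebra p) (W.fineSelmerDualData κ hγ).X 𝔮 ≤
        Module.lengthAt (IwasawaAlgebra p) (F ⧸ (IwasawaAlgebra p) ∙ z) 𝔮)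
    (y : I.H) (lam : IwasawaAlgebra p) (hlam : PowerSeries.constantCoeff lam ≠ 0) (hjy : j y = lam • z)
    (hnt : ¬ IsOfFinAddOrder (I.proj 0 y)) :
    Finite (endInvariants (W.conjFineSelmerInfty κ γ - 1)) ∧
      Finite (integralH1 (tateRep W p) p (κ.layerSubgroup 0) ⧸
        Submodule.span ℤ_[p] {(⟨I.proj 0 y, I.proj_mem 0 y⟩ : integralH1 (tateRep W p) p (κ.layerSubgroup 0))}) ∧
      (PowerSeries.constantCoeff lam).valuation + padicValNat p (Nat.card (endInvariants (W.conjFineSelmerInfty κ γ - 1))) ≤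
        padicValNat p (Nat.card (integralH1 (tateRep W p) p (κ.layerSubgroup 0) ⧸
          Submodule.span ℤ_[p] {(⟨I.proj 0 y, I.proj_mem 0 y⟩ : integralH1 (tateRep W p) p (κ.layerSubgroup 0))})) := by
  -- `μ(X₀) = 0` on the reducible row (statement (A): Ferrero–Washington + Lim 3.5), on the pinned datum `Y`
  have hA := ReducibleFineSelmerMuZero.fineSelmerDual_moduleFinite_of_not_irreducible hLim hFW W p hp hred κ hκ
  have hfinp : Set.Finite {t : W.fineSelmerInfty κ | p • t = 0} :=
    (IwasawaModuleFinitePadicInt.exists_fineSelmerDualData_moduleFinite_iff_finite_pTorsion W κ hγ).mp hA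
  haveI : Module.Finite (IwasawaAlgebra p) (W.fineSelmerDualData κ hγ).X := (W.fineSelmerDualData κ hγ).module_finite_of_finite_pTorsion hγ hfinp
  haveI : Finite ((W.fineSelmerDualData κ hγ).X ⧸ (IwasawaAlgebra.augIdealP p • (⊤ : Submodule (IwasawaAlgebra p) (W.fineSelmerDualData κ hγ).X))) :=
    (W.fineSelmerDualData κ hγ).finite_quotient_augIdealP_of_finite_pTorsion hfinp
  -- instances on `𝐇¹_Γ` and `J.H2`
  haveI : Module.Finite (IwasawaAlgebra p) I.H := IwasawaH1Data.module_finite_of_isCyclotomic hκ hγ I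
  haveI := I.noZeroSMulDivisors hγ
  haveI := J.finite_H2
  -- `y ≠ 0`, `𝐇¹_Γ/Λy` torsion with finite `Γ`-coinvariants, hence `ℓ_{(T)}(F/Λz) = 0`
  have hy0 : y ≠ 0 := by
    rintro rfl
    exact hnt (by rw [map_zero]; exact isOfFinAddOrder_iff_nsmul_eq_zero.mpr ⟨1, one_pos, by simp⟩)
  have htorsHy : Module.IsTorsion (IwasawaAlgebra p) (I.H ⧸ Submodule.span (IwasawaAlgebra p) {y}) :=
    ReducibleZetaDivisibility.isTorsion_quotient_span_singleton_of_ne_zero W p hκ hγ I hy0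
  obtain ⟨-, hfinHy⟩ := ReducibleFineSelmerDescentCount.finite_coinvariants_quotient_span_of_not_isOfFinAddOrder hκ hγ I y hnt
  have hTHy : Module.lengthAt (IwasawaAlgebra p) (I.H ⧸ Submodule.span (IwasawaAlgebra p) {y}) (primeT p) = 0 :=
    lengthAt_primeT_eq_zero_of_finite_coinvariants _ htorsHy hfinHy
  have hTFjy : Module.lengthAt (IwasawaAlgebra p) (F ⧸ (IwasawaAlgebra p) ∙ j y) (primeT p) = 0 := by
    rw [← lengthAt_quotient_span_eq_of_finite_coker j hj hcok y (primeT p) (le_of_eq (height_primeT p))]; exact hTHy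
  have hTFz : Module.lengthAt (IwasawaAlgebra p) (F ⧸ (IwasawaAlgebra p) ∙ z) (primeT p) = 0 := by
    have hle : ((IwasawaAlgebra p) ∙ j y) ≤ (IwasawaAlgebra p) ∙ z := by
      rw [hjy, Submodule.span_singleton_le_iff_mem]
      exact Submodule.smul_mem _ _ (Submodule.mem_span_singleton_self z)
    have h1 := Module.lengthAt_le_of_surjective (Submodule.factor hle) (Submodule.factor_surjective hle) (primeT p)
    rw [hTFjy] at h1
    exact le_antisymm h1 bot_le
  -- the divisibility for `J.H2` at EVERY height-one prime
  have hdivJ : ∀ 𝔮 : PrimeSpectrum (IwasawaAlgebra p), 𝔮.asIdeal.height = 1 →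
      Module.lengthAt (IwasawaAlgebra p) J.H2 𝔮 ≤ Module.lengthAt (IwasawaAlgebra p) (F ⧸ (IwasawaAlgebra p) ∙ z) 𝔮 := by
    intro 𝔮 h𝔮
    rw [← lengthAt_eq_of_injective_of_finite_quotient eX heX hcokX 𝔮 (le_of_eq h𝔮)]
    by_cases hq : 𝔮.asIdeal = augIdealP p
    · rw [Rank1Residual.KatoMuSkeleton.lengthAt_eq_zero_of_finite_quotient_p (M := (W.fineSelmerDualData κ hγ).X) 𝔮 hq]
      exact bot_le
    · exact hdiv 𝔮 h𝔮 hq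
  -- `(J.H2)_Γ` finite
  have hTJ : Module.lengthAt (IwasawaAlgebra p) J.H2 (primeT p) = 0 :=
    le_antisymm ((hdivJ (primeT p) (height_primeT p)).trans (le_of_eq hTFz)) bot_le
  obtain ⟨-, hfinJ, -⟩ := card_coinvariants_of_lengthAt_eq_zero J.H2 J.isTorsion_H2 hTJ
  -- the index is finite and non-zero
  haveI hfinIdx := ReducibleFineSelmerDescentCount.finite_quotient_span_of_not_isOfFinAddOrder I y hnt
  have hne : Nat.card (J.A ⧸ (IwasawaAlgebra p) ∙ J.ι (Submodule.Quotient.mk y)) ≠ 0 := by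
    rw [natCard_quotient_ι_eq_index hκ hγ J y]; exact Nat.card_pos.ne'
  -- seat g3's hull descent with the multiplier, on `H2 := J.H2`
  have hhull := Kato2004.valuation_add_padicValNat_coinvariants_le_of_hull_smul j hj hcok z hz hFZ J.isTorsion_H2 hdivJ y lam
    hlam hjy J.ι J.π J.ι_injective J.π_surjective J.exact_ι_π hfinJ hne
  rw [natCard_quotient_ι_eq_index hκ hγ J y] at hhull
  -- `(X₀)_Γ` is finite with `ord #(X₀)_Γ ≤ ord #(J.H2)_Γ`, and `#(X₀)_Γ = #Sel₀(ℚ_∞)^Γ`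
  have hTY : Module.lengthAt (IwasawaAlgebra p) (W.fineSelmerDualData κ hγ).X (primeT p) = 0 := by
    rw [lengthAt_eq_of_injective_of_finite_quotient eX heX hcokX (primeT p) (le_of_eq (height_primeT p))]; exact hTJ
  have hYtors : Module.IsTorsion (IwasawaAlgebra p) (W.fineSelmerDualData κ hγ).X := isTorsion_of_injective eX heX J.isTorsion_H2
  obtain ⟨-, hfinY, -⟩ := card_coinvariants_of_lengthAt_eq_zero (W.fineSelmerDualData κ hγ).X hYtors hTY
  obtain ⟨-, -, hXJ⟩ := finite_coinvariants_and_padicValNat_le_of_embedding J eX heX hcokX hfinY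
  have hD := (W.fineSelmerDualData κ hγ).isDualPair hγ
  refine ⟨hD.finite_coinvariants_iff.mp hfinY, hfinIdx, ?_⟩
  rw [← hD.natCard_coinvariants]
  omega

end Hull

end Summit.BirchSwinnertonDyer.BirchSwinnertonDyer.Theorems.ReducibleHullDescentCount

end
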